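import Summits.BirchSwinnertonDyer.BirchSwinnertonDyer.Theorems.EisensteinPrimesFullDescentTheoremA
import Summits.BirchSwinnertonDyer.BirchSwinnertonDyer.Theorems.EisensteinPrimesFullDescentOrdinaryAtThree
import Summits.BirchSwinnertonDyer.BirchSwinnertonDyer.Theorems.EisensteinPrimesFullDescentNoUnramifiedCharacter
import Summits.BirchSwinnertonDyer.BirchSwinnertonDyer.Theorems.EisensteinPrimesFullDescentKummerModule
import Literature.NumberTheory.EllipticCurves.OpenImageMazurCharacterProofs
import HarnessLib

/-!
# Route `EisensteinPrimes`, crux 2 `GoodLatticeBDPValue` (stmt-BirchSwinnertonDyer-19032), line `halves` v21 —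
# stub 3a-B (Theorem T′), brick F7 second half: **THEOREM A-II — a rational cyclic group of order `9` over the
# `ω`-line is impossible**, and **THEOREM A**

Cell `bsd-eis` (home `run/shared/lean/pub/bsd-eis/`), LEAD seat `bsd-line-x1-p1` (gen 5; `--supports -19032`, closes
nothing by itself). Second half of the piece `hA` of the LEAD's assembly `FullDescentAssembly.fullDescentAtThreeOfRed_of_pieces`
(road memo `HOME/line-x1-p1-w3-g4/AN3-StubB-elementary-road.md`, §2 CASE ω, steps A3–A5). Given the output of Theorem A-I
(`FullDescentTheoremA.exists_stable_nine_of_omega_point`: a `Γ_ℚ`-stable `B ≤ E[9]` of order `9` with `B ∩ E[3] = ⟨Q⟩`,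
`Q` the `ω`-point) under the standing hypotheses (`3` good ordinary; every `v ∤ 3` good or split multiplicative with
`ℓ_v ≡ 2 (mod 3)`):

* §1 `B = ⟨b⟩` is cyclic of order `9` and carries a character `ψ_B : Γ_ℚ →* (ℤ/9)ˣ` (`σ b = ψ_B(σ) b`);
* §2 (A3 at a split `ℓ ≡ 2`) the level-`9` Tate basis and (T-f)/(T-c) (w3 gen 4): `B = ⟨P₁'⟩ = Ψ(μ₉)`, so the whole
  decomposition group acts on `B` through `χ̄₉`; (A3 at a good `v ∤ 3`) Néron–Ogg–Shafarevich: inertia is trivial on `B`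
  and `χ̄₉` is unramified;
* §3 (A3 at `3`, A5) w4 gen 6's `Rat.exists_kernel_of_omegaLine_atThree`: `B = K₉` (uniqueness of the decomposition-stable
  complement), inertia acts on it through `χ̄₉`, and the decomposition group is NOT trivial on `E[9]/K₉` (else
  `9 ≤ #Ẽ(𝔽₃) ≤ 7`);
* §4 (A4) `ψ_B χ̄₉⁻¹` kills every inertia group, hence is trivial (w2 gen 5's (G-ℚ)
  `monoidHom_eq_one_of_forall_greenbergInertia`): `ψ_B = χ̄₉`; by the Weil pairing (w4 gen 6's
  `smul_sub_mem_of_smul_eq_modNCyclotomicCharacter_of_cyclic`) `Γ_ℚ` is then trivial on `E[9]/B` — contradiction.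
  THEOREM A = A-II ∘ A-I, in the shape `hA` of the assembly.

HONEST FRAMING: helper theorems only (0 definitions, 0 named facts, 0 sorry); no summit statement, no BSD / IMC /
Keller–Yin theorem and no stub of the registered skeleton is proved by this file alone. References: [Kriz2016] Thm. 34;
[SilvermanATAEC1994] V.3.1, Lemma V.5.2, Thm. V.5.3; [SilvermanAEC2009] III.8 (Weil pairing), VII.4.1; [Serre1972] §1.11;
[NeukirchANT1999] III (2.17)–(2.18), II §9 (9.6).
-/

set_option autoImplicit false

-- the route's Theorems namespace repeats the summit name by design (D-0017 nested layout)
set_option linter.dupNamespace false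

noncomputable section

open scoped Classical NumberField

namespace Summit.BirchSwinnertonDyer.BirchSwinnertonDyer.Theorems.FullDescentTheoremA

open NumberField IsDedekindDomain Field WeierstrassCurve Rat.HeightOneSpectrum
  Literature.NumberTheory.EllipticCurves Literature.NumberTheory.GaloisRepresentations
  Summit.BirchSwinnertonDyer.BirchSwinnertonDyer.Theorems

variable (W : WeierstrassCurve ℚ) [W.IsElliptic]

/-! ## §1. `B` is cyclic of order `9`; its character `ψ_B` -/

omit [W.IsElliptic] in
/-- Scalars on a point of order `9` are determined mod `9`. [folklore] -/
theorem zsmul_eq_zsmul_iff_of_addOrderOf_eq_nine {b : geomPoints W} (hb : addOrderOf b = 9) (m n : ℤ) :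
    m • b = n • b ↔ (9 : ℤ) ∣ m - n := by
  rw [← sub_eq_zero, ← sub_smul, ← addOrderOf_dvd_iff_zsmul_eq_zero, hb]
  rfl

omit [W.IsElliptic] in
/-- A unit of `ℤ/9` is determined by its action on a point of order `9`. [folklore] -/
theorem units_eq_of_val_smul_eq {b : geomPoints W} (hb : addOrderOf b = 9) {u w : (ZMod 9)ˣ}
    (h : ((u : ZMod 9)).val • b = ((w : ZMod 9)).val • b) : u = w := by
  rw [← natCast_zsmul, ← natCast_zsmul, zsmul_eq_zsmul_iff_of_addOrderOf_eq_nine W hb] at h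
  ext
  have h' : (((u : ZMod 9).val : ℤ) : ZMod 9) = (((w : ZMod 9).val : ℤ) : ZMod 9) :=
    (ZMod.intCast_eq_intCast_iff_dvd_sub _ _ 9).mpr (by simpa using dvd_sub_comm.mp h)
  simpa using h'

omit [W.IsElliptic] in
/-- **`B` is cyclic of order `9` with a character.** For a `Γ_ℚ`-stable `B ≤ E[9]` of order `9` whose `3`-torsion is the
line `⟨Q⟩` (`Q ≠ 0` in `E[3]`): `B = ⟨b⟩` with `b` of order `9`, and `σ b = ψ(σ) b` for a homomorphism
`ψ : Γ_ℚ → (ℤ/9)ˣ` whose kernel is the (open) stabiliser of `b`. [folklore] -/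
theorem exists_generator_character {Q : geomTorsion W ((3 : ℕ) : ℤ)} (hQ0 : Q ≠ 0)
    {B : AddSubgroup (geomPoints W)} (hB9 : B ≤ geomTorsion W ((9 : ℕ) : ℤ)) (hcardB : Nat.card B = 9)
    (hBinf : B ⊓ geomTorsion W ((3 : ℕ) : ℤ) = AddSubgroup.zmultiples (Q : geomPoints W))
    (hBst : ∀ σ : absoluteGaloisGroup ℚ, ∀ x ∈ B, σ • x ∈ B) :
    ∃ b : geomPoints W, B = AddSubgroup.zmultiples b ∧ addOrderOf b = 9 ∧
      ∃ ψ : absoluteGaloisGroup ℚ →* (ZMod 9)ˣ,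
        (∀ σ : absoluteGaloisGroup ℚ, σ • b = ((ψ σ : (ZMod 9)ˣ) : ZMod 9).val • b) ∧
        IsOpen ((ψ.ker : Subgroup (absoluteGaloisGroup ℚ)) : Set (absoluteGaloisGroup ℚ)) := by
  haveI : Fact (Nat.Prime 3) := ⟨Nat.prime_three⟩
  have hcC : Nat.card (AddSubgroup.zmultiples (Q : geomPoints W)) = 3 := by
    rw [Nat.card_zmultiples, AddSubgroup.addOrderOf_coe, addOrderOf_eq_of_ne_zero W 3 hQ0]
  have hCB : AddSubgroup.zmultiples (Q : geomPoints W) ≤ B := hBinf ▸ inf_le_left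
  -- an element of `B` off `⟨Q⟩`, necessarily of order `9`
  obtain ⟨b, hbB, hbC⟩ := FullDescentKummerModule.exists_mem_not_mem_of_card hCB (by norm_num : (3 : ℕ) ≠ 0) hcC
    (by rw [hcardB])
  have hb9 : ((9 : ℕ) : ℤ) • b = 0 := mem_torsionBy_iff.mp (hB9 hbB)
  have hb3 : ¬ (3 : ℤ) • b = 0 := by
    intro h
    apply hbC
    rw [← hBinf]
    exact AddSubgroup.mem_inf.mpr ⟨hbB, mem_torsionBy_iff.mpr (by exact_mod_cast h)⟩
  have hordb : addOrderOf b = 9 := by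
    have h9 : (3 : ℕ) ^ (1 + 1) • b = 0 := by
      rw [← natCast_zsmul]; exact_mod_cast hb9
    have h3 : ¬ (3 : ℕ) ^ 1 • b = 0 := by
      rw [pow_one, ← natCast_zsmul]; exact_mod_cast hb3
    simpa using addOrderOf_eq_prime_pow h3 h9
  have hBb : B = AddSubgroup.zmultiples b := by
    haveI : Finite B := Nat.finite_of_card_ne_zero (by rw [hcardB]; norm_num)
    refine (AddSubgroup.eq_of_le_of_card_ge (AddSubgroup.zmultiples_le_of_mem hbB) ?_).symm
    rw [hcardB, Nat.card_zmultiples, hordb]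
  -- the exponent `e σ` with `σ b = e σ • b`
  have hex : ∀ σ : absoluteGaloisGroup ℚ, ∃ k : ℤ, σ • b = k • b := fun σ ↦ by
    have h := hBst σ b hbB
    rw [hBb] at h
    obtain ⟨k, hk⟩ := AddSubgroup.mem_zmultiples_iff.mp h
    exact ⟨k, hk.symm⟩
  choose e he using hex
  have hσz : ∀ (σ : absoluteGaloisGroup ℚ) (k : ℤ) (x : geomPoints W), σ • (k • x) = k • (σ • x) :=
    fun σ k x ↦ map_zsmul (DistribSMul.toAddMonoidHom _ σ) k x
  have hone : (9 : ℤ) ∣ e 1 - 1 := by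
    rw [← zsmul_eq_zsmul_iff_of_addOrderOf_eq_nine W hordb, ← he 1, one_smul, one_smul]
  have hmul : ∀ σ τ, (9 : ℤ) ∣ e (σ * τ) - e σ * e τ := fun σ τ ↦ by
    rw [← zsmul_eq_zsmul_iff_of_addOrderOf_eq_nine W hordb, ← he, mul_smul, he τ, hσz, he σ, smul_smul, mul_comm]
  -- the character into the multiplicative monoid `ℤ/9`, then into its units
  let ψ₀ : absoluteGaloisGroup ℚ →* ZMod 9 :=
    { toFun := fun σ ↦ ((e σ : ℤ) : ZMod 9)
      map_one' := by
        have h := (ZMod.intCast_eq_intCast_iff_dvd_sub (1 : ℤ) (e 1) 9).mpr hone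
        rw [Int.cast_one] at h
        exact h.symm
      map_mul' := fun σ τ ↦ by
        have h := (ZMod.intCast_eq_intCast_iff_dvd_sub (e σ * e τ) (e (σ * τ)) 9).mpr (hmul σ τ)
        rw [Int.cast_mul] at h
        exact h.symm }
  have hψ₀ : ∀ σ, ψ₀ σ = ((e σ : ℤ) : ZMod 9) := fun _ ↦ rfl
  refine ⟨b, hBb, hordb, ψ₀.toHomUnits, fun σ ↦ ?_, ?_⟩
  · rw [MonoidHom.coe_toHomUnits, hψ₀, he σ, ← natCast_zsmul, zsmul_eq_zsmul_iff_of_addOrderOf_eq_nine W hordb,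
      ZMod.val_intCast]
    exact (Int.mod_modEq _ _).dvd
  · -- the kernel is the stabiliser of `b`
    have hker : ((ψ₀.toHomUnits).ker : Set (absoluteGaloisGroup ℚ)) =
        MulAction.stabilizer (absoluteGaloisGroup ℚ) b := by
      ext σ
      simp only [SetLike.mem_coe, MonoidHom.mem_ker, MulAction.mem_stabilizer_iff]
      constructor
      · intro h
        have h' : ((ψ₀.toHomUnits σ : (ZMod 9)ˣ) : ZMod 9) = 1 := by rw [h, Units.val_one]
        rw [MonoidHom.coe_toHomUnits, hψ₀] at h'
        rw [he σ]
        have h9 : (9 : ℤ) ∣ e σ - 1 := by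
          have := (ZMod.intCast_eq_intCast_iff_dvd_sub 1 (e σ) 9).mp (by rw [Int.cast_one]; exact h'.symm)
          exact this
        rw [(zsmul_eq_zsmul_iff_of_addOrderOf_eq_nine W hordb (e σ) 1).mpr h9, one_smul]
      · intro h
        ext
        rw [MonoidHom.coe_toHomUnits, hψ₀, Units.val_one]
        have h9 : (9 : ℤ) ∣ e σ - 1 := by
          rw [← zsmul_eq_zsmul_iff_of_addOrderOf_eq_nine W hordb, ← he σ, one_smul, h]
        have := (ZMod.intCast_eq_intCast_iff_dvd_sub 1 (e σ) 9).mpr h9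
        rw [Int.cast_one] at this
        exact this.symm
    rw [hker]
    exact W.isOpen_stabilizer_point_holds b


/-! ## §2. A3 at a split multiplicative `ℓ ≡ 2 (mod 3)`: the decomposition group acts on `B` through `χ̄₉` -/

/-- **A3 at a bad place.** `W/ℚ` split multiplicative at `v` with `ℓ_v ≡ 2 (mod 3)`, `Q ≠ 0` the `ω`-point, `B ≤ E[9]` of
order `9`, stable under `Γ_ℚ`, with `B ∩ E[3] = ⟨Q⟩`: every element of the decomposition group `res(Γ_{ℚ_v})` acts on `B`
through `χ̄₉`. In the level-`9` Tate basis: `⟨Q⟩ = ⟨3P₁'⟩` ((T-f)) and then `B = ⟨P₁'⟩ = Ψ(μ₉)` ((T-c)), on which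
`res τ` acts by `χ̄₉(res τ)`. [cite: SilvermanATAEC1994, Thm. V.3.1 (c),(d), Lemma V.5.2, Thm. V.5.3]
[cite: NeukirchANT1999, Ch. I §10 (10.3), Ch. II §9 Prop. (9.6)] -/
theorem smul_eq_chi_nine_smul_of_split {v : HeightOneSpectrum (𝓞 ℚ)} (hv3 : natGenerator v ≠ 3)
    (hsplit : W.HasSplitMultiplicativeReductionAt v) (hmod : natGenerator v % 3 = 2)
    {Q : geomTorsion W ((3 : ℕ) : ℤ)} (hQ0 : Q ≠ 0)
    (hQ : ∀ σ : absoluteGaloisGroup ℚ, σ • Q = ((modNCyclotomicCharacter ℚ 3 σ : (ZMod 3)ˣ) : ZMod 3).val • Q)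
    {B : AddSubgroup (geomPoints W)} (hB9 : B ≤ geomTorsion W ((9 : ℕ) : ℤ)) (hcardB : Nat.card B = 9)
    (hBinf : B ⊓ geomTorsion W ((3 : ℕ) : ℤ) = AddSubgroup.zmultiples (Q : geomPoints W))
    (hBst : ∀ σ : absoluteGaloisGroup ℚ, ∀ x ∈ B, σ • x ∈ B)
    (τ : absoluteGaloisGroup (v.adicCompletion ℚ)) {x : geomPoints W} (hx : x ∈ B) :
    absGaloisRestrict ℚ (v.adicCompletion ℚ) τ • x =
      ((modNCyclotomicCharacter ℚ 9 (absGaloisRestrict ℚ (v.adicCompletion ℚ) τ) : (ZMod 9)ˣ) : ZMod 9).val • x := by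
  haveI : Fact (Nat.Prime 3) := ⟨Nat.prime_three⟩
  haveI hℓ : Fact (primesEquiv v : ℕ).Prime := ⟨(primesEquiv v).2⟩
  have hv : ((primesEquiv v : Nat.Primes) : ℕ) = natGenerator v := rfl
  -- the level-9 Tate basis
  obtain ⟨P₁, P₂, κ, -, -, hgen, hrel, hP₁, hP₂⟩ :=
    FullDescentTateBasis.exists_tateBasis_geomPoints_of_hasSplitMultiplicativeReductionAt W v hsplit (N := 9)
  letI inst : DistribMulAction (absoluteGaloisGroup (v.adicCompletion ℚ)) (geomPoints W) :=
    DistribMulAction.compHom _ (absGaloisRestrict ℚ (v.adicCompletion ℚ)).toMonoidHom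
  have hdef : ∀ (σ : absoluteGaloisGroup (v.adicCompletion ℚ)) (y : geomPoints W),
      σ • y = absGaloisRestrict ℚ (v.adicCompletion ℚ) σ • y := fun _ _ ↦ rfl
  set χ : absoluteGaloisGroup (v.adicCompletion ℚ) → ℤ := fun σ ↦
    (((modNCyclotomicCharacter ℚ 9 (absGaloisRestrict ℚ (v.adicCompletion ℚ) σ) : (ZMod 9)ˣ) : ZMod 9).val : ℤ)
    with hχ
  set κ' : absoluteGaloisGroup (v.adicCompletion ℚ) → ℤ := fun σ ↦ (κ σ : ℤ) with hκ'
  have hgen' : ∀ P : geomPoints W, (9 : ℤ) • P = 0 → ∃ a b : ℤ, P = a • P₁ + b • P₂ := fun P hP ↦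
    hgen P (by simpa using hP)
  have hrel' : ∀ a b : ℤ, a • P₁ + b • P₂ = 0 ↔ (9 : ℤ) ∣ a ∧ (9 : ℤ) ∣ b := fun a b ↦ by
    simpa using hrel a b
  have hP₁' : ∀ σ : absoluteGaloisGroup (v.adicCompletion ℚ), σ • P₁ = χ σ • P₁ := fun σ ↦ by
    rw [hdef, hP₁ σ, hχ, natCast_zsmul]
  have hP₂' : ∀ σ : absoluteGaloisGroup (v.adicCompletion ℚ), σ • P₂ = P₂ + κ' σ • P₁ := fun σ ↦ by
    rw [hdef, hP₂ σ, hκ', natCast_zsmul]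
  obtain ⟨hgen3, hrel3, hP₁3, hP₂3⟩ := FullDescentTateAlgebra.basis_three_of_basis_nine hgen' hrel' hP₁' hP₂'
  -- a Frobenius: `χ̄₉(res σ₀) = ℓ`, `ℓ ≡ 2 (mod 3)`
  obtain ⟨𝔐, h𝔐⟩ := v.localPrimesAbove_nonempty
  obtain ⟨σ₀, hσ₀⟩ := IsDedekindDomain.HeightOneSpectrum.exists_isArithFrobAt_localAbsIntegers v h𝔐
  have hℓ3 : ¬ natGenerator v ∣ 3 := fun h ↦
    hv3 ((Nat.prime_dvd_prime_iff_eq (prime_natGenerator v) Nat.prime_three).mp h)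
  have hℓ9 : ¬ natGenerator v ∣ 9 := fun h ↦
    hℓ3 ((Nat.Prime.dvd_mul (prime_natGenerator v)).mp (by simpa using h) |>.elim id id)
  have hχσ₀ : χ σ₀ = ((natGenerator v % 9 : ℕ) : ℤ) := by
    have h := EisensteinPrimesLinePsiAtMultiplicativePrime.modNCyclotomicCharacter_absGaloisRestrict_frob
      (p := natGenerator v) hv h𝔐 hσ₀ 9 hℓ9
    simp only [hχ]
    rw [h, ZMod.val_natCast]
  have hσ₀' : ¬ (3 : ℤ) ∣ χ σ₀ - 1 := by
    rw [hχσ₀]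
    have h9 : natGenerator v % 9 % 3 = 2 := by rw [Nat.mod_mod_of_dvd _ (by norm_num : 3 ∣ 9)]; exact hmod
    omega
  have hχ3σ₀ : (((modNCyclotomicCharacter ℚ 3 (absGaloisRestrict ℚ (v.adicCompletion ℚ) σ₀) : (ZMod 3)ˣ) :
      ZMod 3).val : ℤ) = ((natGenerator v % 3 : ℕ) : ℤ) := by
    have h := EisensteinPrimesLinePsiAtMultiplicativePrime.modNCyclotomicCharacter_absGaloisRestrict_frob
      (p := natGenerator v) hv h𝔐 hσ₀ 3 hℓ3
    rw [h, ZMod.val_natCast]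
  have hQ3 : (3 : ℤ) • (Q : geomPoints W) = 0 := by
    have h : ((3 : ℕ) : ℤ) • (Q : geomPoints W) = 0 := mem_torsionBy_iff.mp Q.2
    exact_mod_cast h
  have hact : ∀ y ∈ AddSubgroup.zmultiples (Q : geomPoints W), σ₀ • y = χ σ₀ • y := by
    intro y hy
    rw [hdef, smul_eq_chi_smul_of_mem_zmultiples W hQ _ hy, hχ3σ₀, hχσ₀]
    obtain ⟨k, rfl⟩ := AddSubgroup.mem_zmultiples_iff.mp hy
    obtain ⟨t, ht⟩ : ∃ t : ℤ, ((natGenerator v % 9 : ℕ) : ℤ) = ((natGenerator v % 3 : ℕ) : ℤ) + 3 * t := by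
      refine ⟨(((natGenerator v % 9 : ℕ) : ℤ) - ((natGenerator v % 3 : ℕ) : ℤ)) / 3, ?_⟩
      have h1 : (natGenerator v % 9) % 3 = natGenerator v % 3 := Nat.mod_mod_of_dvd _ (by norm_num)
      omega
    have h3kQ : (3 : ℤ) • (k • (Q : geomPoints W)) = 0 := by rw [smul_comm, hQ3, smul_zero]
    rw [ht, add_smul, mul_comm (3 : ℤ) t, mul_smul, h3kQ, smul_zero, add_zero]
  -- (T-f): `⟨Q⟩ = ⟨3P₁⟩`
  have hCcard : Nat.card (AddSubgroup.zmultiples (Q : geomPoints W)) = 3 := by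
    rw [Nat.card_zmultiples, AddSubgroup.addOrderOf_coe, addOrderOf_eq_of_ne_zero W 3 hQ0]
  have hC : AddSubgroup.zmultiples (Q : geomPoints W) = AddSubgroup.zmultiples ((3 : ℤ) • P₁) :=
    FullDescentTateAlgebra.eq_zmultiples_fst_of_smul_eq_chi_three hgen3 hrel3 hP₁3 hP₂3 hσ₀' hCcard hact
  -- (T-c): `B = ⟨P₁⟩`
  have hB : B = AddSubgroup.zmultiples P₁ :=
    FullDescentTateAlgebra.eq_zmultiples_fst_of_stable_nine hgen' hrel' hP₁' hP₂' hσ₀' hcardB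
      (fun y hy ↦ by have h : ((9 : ℕ) : ℤ) • y = 0 := mem_torsionBy_iff.mp (hB9 hy); exact_mod_cast h)
      (fun y hy ↦ by rw [hdef]; exact hBst _ y hy)
      (fun y hy hy3 ↦ by
        rw [← hC, ← hBinf]
        exact AddSubgroup.mem_inf.mpr ⟨hy, mem_torsionBy_iff.mpr (by exact_mod_cast hy3)⟩)
  -- conclusion on `x = k • P₁`
  rw [hB] at hx
  obtain ⟨k, rfl⟩ := AddSubgroup.mem_zmultiples_iff.mp hx
  rw [FullDescentTateAlgebra.smul_zsmul_comm, hP₁ τ, smul_comm]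


/-! ## §3. Theorem A-II and Theorem A -/

/-- **Theorem A-II (AN-3 road, steps A3–A5): a rational cyclic group of order `9` over the `ω`-line is impossible.**
`W/ℚ` globally minimal with good ORDINARY reduction at `3`; every `v ∤ 3` good or split multiplicative with `ℓ_v ≡ 2 (mod 3)`;
`Q ≠ 0` the `ω`-point of `E[3]`; `B ≤ E[9]` of order `9`, `Γ_ℚ`-stable, `B ∩ E[3] = ⟨Q⟩`. Then `False`: the character
`ψ_B` of the cyclic `B` (§1) agrees with `χ̄₉` on every inertia group (§2 at split places, Néron–Ogg–Shafarevich at good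
places, w4 gen 6's `K₉ = B` at `3`), so `ψ_B = χ̄₉` by (G-ℚ) (w2 gen 5); by the Weil pairing (w4 gen 6's F3e) `Γ_ℚ` is then
trivial on `E[9]/B = E[9]/K₉`, which the Frobenius at `3` forbids (`9 ≤ #Ẽ(𝔽₃) ≤ 7`).
[cite: Kriz2016, Thm. 34] [cite: Serre1972, §1.11 Prop. 11] [cite: NeukirchANT1999, Ch. III Thm. (2.17), Cor. (2.18)]
[cite: SilvermanAEC2009, III.8 (Weil pairing)] -/
theorem false_of_stable_nine [W.IsGloballyMinimal]
    (h3 : W.HasGoodReductionAtPrime 3) (hord : ¬ (3 : ℤ) ∣ W.frobeniusTrace 3)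
    (hH : ∀ v : HeightOneSpectrum (𝓞 ℚ), natGenerator v ≠ 3 →
      W.HasGoodReductionAt v ∨ (W.HasSplitMultiplicativeReductionAt v ∧ natGenerator v % 3 = 2))
    {Q : geomTorsion W ((3 : ℕ) : ℤ)} (hQ0 : Q ≠ 0)
    (hQ : ∀ σ : absoluteGaloisGroup ℚ, σ • Q = ((modNCyclotomicCharacter ℚ 3 σ : (ZMod 3)ˣ) : ZMod 3).val • Q)
    {B : AddSubgroup (geomPoints W)} (hB9 : B ≤ geomTorsion W ((9 : ℕ) : ℤ)) (hcardB : Nat.card B = 9)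
    (hBinf : B ⊓ geomTorsion W ((3 : ℕ) : ℤ) = AddSubgroup.zmultiples (Q : geomPoints W))
    (hBst : ∀ σ : absoluteGaloisGroup ℚ, ∀ x ∈ B, σ • x ∈ B) : False := by
  haveI : Fact (Nat.Prime 3) := ⟨Nat.prime_three⟩
  -- §1: generator and character
  obtain ⟨b, hBb, hordb, ψ, hψ, hψker⟩ := exists_generator_character W hQ0 hB9 hcardB hBinf hBst
  have hbB : b ∈ B := by rw [hBb]; exact AddSubgroup.mem_zmultiples b
  have hb9 : b ∈ geomTorsion W ((9 : ℕ) : ℤ) := hB9 hbB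
  -- the place above `3` and w4 gen 6's kernel `K₂ = B`
  obtain ⟨v₃, hv₃'⟩ : ∃ v₃ : HeightOneSpectrum (𝓞 ℚ), primesEquiv v₃ = ⟨3, Nat.prime_three⟩ :=
    ⟨(primesEquiv (R := 𝓞 ℚ)).symm ⟨3, Nat.prime_three⟩, Equiv.apply_symm_apply _ _⟩
  have hv₃ : natGenerator v₃ = 3 := congrArg Subtype.val hv₃'
  obtain ⟨K₂, -, -, -, -, -, -, -, hKχ, hKnot, hKuniq⟩ :=
    FullDescentOrdinaryNine.Rat.exists_kernel_of_omegaLine_atThree W h3 hord hv₃ hQ0 (fun δ _ ↦ hQ δ)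
  have hCmap : (AddSubgroup.zmultiples Q).map (geomTorsion W ((3 : ℕ) : ℤ)).subtype =
      AddSubgroup.zmultiples (Q : geomPoints W) := AddMonoidHom.map_zmultiples _ _
  have hBK : B = K₂ := hKuniq B hB9 hcardB (fun δ _ x hx ↦ hBst δ x hx) (by rw [hCmap]; exact hBinf)
  -- `φ = ψ χ̄₉⁻¹` kills every inertia group
  have hI : ∀ (v : HeightOneSpectrum (𝓞 ℚ)), ∀ τ ∈ GreenbergSelmer.inertia (K := ℚ) v,
      (ψ * (modNCyclotomicCharacter ℚ 9)⁻¹) τ = 1 := by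
    intro v τ hτ
    rw [MonoidHom.mul_apply, MonoidHom.inv_apply, mul_inv_eq_one]
    apply units_eq_of_val_smul_eq W hordb
    rw [← hψ τ]
    by_cases hv : natGenerator v = 3
    · have hvv : v = v₃ :=
        (primesEquiv (R := 𝓞 ℚ)).injective (Subtype.ext (hv.trans hv₃.symm))
      rw [hvv] at hτ
      exact hKχ τ hτ b (hBK ▸ hbB)
    · obtain ⟨τ', hτ', rfl⟩ := Subgroup.mem_map.mp hτ
      rcases hH v hv with hgood | ⟨hsplit, hmod⟩
      · -- Néron–Ogg–Shafarevich on `E[9]` and `χ̄₉` unramified at `v`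
        have h9v : ¬ natGenerator v ∣ 9 := fun h ↦ hv ((Nat.prime_dvd_prime_iff_eq (prime_natGenerator v)
          Nat.prime_three).mp (((Nat.Prime.dvd_mul (prime_natGenerator v)).mp (by simpa using h)).elim id id))
        have hn : ((((9 : ℕ) : ℤ)) : 𝓞 ℚ) ∉ v.asIdeal := by
          rw [Int.cast_natCast]
          exact fun h ↦ h9v ((Rat.natCast_mem_asIdeal_iff v).mp h)
        have h9v' : ((9 : ℕ) : 𝓞 ℚ) ∉ v.asIdeal := fun h ↦ h9v ((Rat.natCast_mem_asIdeal_iff v).mp h)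
        haveI : NeZero ((9 : ℕ) : ℚ) := ⟨by norm_num⟩
        have hfix := W.smul_eq_of_mem_absInertia_of_hasGoodReductionAt hgood hn hτ' (mem_torsionBy_iff.mp hb9)
        have hχ1 := Literature.NumberTheory.GaloisCohomology.modNCyclotomicCharacter_absGaloisRestrict_eq_one_of_mem_absInertia
          ℚ 9 v h9v' hτ'
        rw [show (absGaloisRestrict ℚ (v.adicCompletion ℚ)).toMonoidHom τ' = absGaloisRestrict ℚ (v.adicCompletion ℚ) τ'
          from rfl, hfix, hχ1, Units.val_one]
        rw [show (1 : ZMod 9).val = 1 from rfl, one_smul]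
      · exact smul_eq_chi_nine_smul_of_split W hv hsplit hmod hQ0 hQ hB9 hcardB hBinf hBst τ' hbB
  have hker : IsOpen (((ψ * (modNCyclotomicCharacter ℚ 9)⁻¹).ker : Subgroup (absoluteGaloisGroup ℚ)) :
      Set (absoluteGaloisGroup ℚ)) := by
    apply Subgroup.isOpen_mono (H₁ := ψ.ker ⊓ (modNCyclotomicCharacter ℚ 9).ker)
    · intro σ hσ
      obtain ⟨h1, h2⟩ := Subgroup.mem_inf.mp hσ
      rw [MonoidHom.mem_ker] at h1 h2 ⊢
      rw [MonoidHom.mul_apply, MonoidHom.inv_apply, h1, h2, inv_one, mul_one]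
    · rw [Subgroup.coe_inf]
      exact hψker.inter (Literature.NumberTheory.EllipticCurves.Mazur1978.isOpen_ker_modNCyclotomicCharacter 9)
  have hφ := FullDescentNoUnramifiedCharacter.monoidHom_eq_one_of_forall_greenbergInertia _ hker hI
  -- so every `σ` acts on `b` through `χ̄₉`
  have hψχ : ∀ σ : absoluteGaloisGroup ℚ,
      σ • b = ((modNCyclotomicCharacter ℚ 9 σ : (ZMod 9)ˣ) : ZMod 9).val • b := by
    intro σ
    have h := congrArg (fun f : absoluteGaloisGroup ℚ →* (ZMod 9)ˣ ↦ f σ) hφ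
    simp only [MonoidHom.mul_apply, MonoidHom.inv_apply, MonoidHom.one_apply, mul_inv_eq_one] at h
    rw [hψ σ, h]
  -- Weil: `Γ_ℚ` is trivial on `E[9]/B`
  haveI : NeZero ((9 : ℕ) : ℚ) := ⟨by norm_num⟩
  have htriv : ∀ (σ : absoluteGaloisGroup ℚ), ∀ y ∈ geomTorsion W ((9 : ℕ) : ℤ),
      σ • y - y ∈ AddSubgroup.zmultiples b := fun σ ↦
    FullDescentOrdinaryNine.smul_sub_mem_zmultiples_of_smul_eq_modNCyclotomicCharacter W 9 (by norm_num) hb9 hordb σ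
      (hψχ σ)
  -- contradiction at `3`
  exact hKnot fun δ _ x hx ↦ by rw [← hBK, hBb]; exact htriv δ x hx

/-- **THEOREM A (AN-3 road, Case `ω` ⇒ ⊥) in the shape `hA` of the LEAD's assembly**
`FullDescentAssembly.fullDescentAtThreeOfRed_of_pieces`: `W/ℚ` globally minimal, `3` good ordinary, every `v ∤ 3` good or
split multiplicative with `ℓ_v ≡ 2 (mod 3)`, and a point `Q ≠ 0` of `E[3]` on which `Γ_ℚ` acts through `χ̄₃` ⟹ `False`
(= A-II ∘ A-I). [cite: Kriz2016, Thm. 34 (1)–(3), Thm. 35] [cite: Serre1972, §1.11 Prop. 11–12] [cite: Mazur1978, §5] -/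
theorem theoremA : ∀ (W : WeierstrassCurve ℚ) [W.IsElliptic] [W.IsGloballyMinimal],
    W.HasGoodReductionAtPrime 3 → ¬ (3 : ℤ) ∣ W.frobeniusTrace 3 →
    (∀ v : HeightOneSpectrum (𝓞 ℚ), natGenerator v ≠ 3 →
      W.HasGoodReductionAt v ∨ (W.HasSplitMultiplicativeReductionAt v ∧ natGenerator v % 3 = 2)) →
    ∀ Q : geomTorsion W ((3 : ℕ) : ℤ), Q ≠ 0 →
      (∀ σ : absoluteGaloisGroup ℚ, σ • Q = ((modNCyclotomicCharacter ℚ 3 σ : (ZMod 3)ˣ) : ZMod 3).val • Q) →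
      False := by
  intro W _ _ h3 hord hH Q hQ0 hQ
  obtain ⟨B, -, hB9, hcardB, hBinf, hBst⟩ := exists_stable_nine_of_omega_point W h3 hord hH Q hQ0 hQ
  exact false_of_stable_nine W h3 hord hH hQ0 hQ hB9 hcardB hBinf hBst

end Summit.BirchSwinnertonDyer.BirchSwinnertonDyer.Theorems.FullDescentTheoremA

end
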